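import Mathlib
import HarnessLib
import HarnessLib.Audit
import Summits.Langlands.Statement
import Summits.Langlands.Langlands.Theses.ParahoricFibre
import Literature.NumberTheory.GaloisRepresentations.OrdinaryRegular
import Literature.NumberTheory.GaloisRepresentations.LocalClassFieldTheory
import Literature.NumberTheory.GaloisRepresentations.LocalArtinMapPinned
import Literature.NumberTheory.GaloisRepresentations.ResidualGaloisRep
import Literature.NumberTheory.GaloisRepresentations.WeilDeligneOfGaloisExistence
import Literature.NumberTheory.GaloisRepresentations.GrothendieckDeligneWeilDeligneExistenceHolds
import Summits.Langlands.Langlands.Theses.SmallRangeOrdinaryCarving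

/-! # BC3 birth skeleton (pre-birth twin: carries verbatim copies of the cell and of the stub statements; `Iff.rfl` to the route decl once born) for
`SmallRangeOrdinaryCarving.OrdinaryBoxGenericMonodromy` (crux, rank 2).  NAMED stubs: stub P `stub_potentialOrdinaryGenericity` (potential ordinary genericity =
Matsumoto 2023 Thm 5.22 ∘ AHTW 2026 Prop 6.0.5 in the target's currency — the cell's open content, PRINT modulo typed junctions) and stub D
`stub_genericityDescends` (descent of genericity along `W_{F'_u} ⊂ W_{K_v}`, local algebra); `OrdinaryBoxGenericMonodromy_of` is a REAL composition (a place `u ∣ v` of `F'`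
by going-up), kernel-checked, sorries ONLY inside `stub_*`.  BC5 rungs A/B are PLAN-ONLY named stubs NOT consumed by `OrdinaryBoxGenericMonodromy_of`. -/

set_option linter.dupNamespace false
set_option linter.unusedVariables false

namespace Summit.Langlands.Langlands.Theses.SmallRangeOrdinaryCarving.Birth.OrdinaryBoxGenericMonodromy

open scoped BigOperators Topology Manifold Classical MeasureTheory ProbabilityTheory Matrix InnerProductSpace ComplexConjugate ContinuousMap NumberField
open Filter Set Function TopologicalSpace MeasureTheory

/-- verbatim copy of the cell `OrdinaryBoxGenericMonodromy` (texts.json; = the route decl by `Iff.rfl` after birth). -/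
def OrdinaryBoxGenericMonodromy : Prop :=
  open IsDedekindDomain NumberField Polynomial Filter Literature.NumberTheory.Automorphic Literature.NumberTheory.GaloisRepresentations in ∀ (K : Type) [Field K] [NumberField K], NumberField.IsCMField K → ∀ (n : ℕ) (hcpt : isCompact_glFiniteIntegralLevel n K) (π : CuspidalAutomorphicRepData n K hcpt), π.1.IsRegularAlgebraic → ∀ (p : ℕ) [Fact p.Prime] (ι : PadicAlgCl p ≃+* ℂ) (ρ : FramedGaloisRep K (PadicAlgCl p) n), ρ.toGaloisRep.IsSemisimple → (∀ᶠ v : HeightOneSpectrum (𝓞 K) in cofinite, ∀ α : Multiset ℂ, π.1.HasSatakeParamAt v α → ρ.IsUnramifiedAt v ∧ ρ.HasFrobCharpolyAt v (arithFrobPolyOfSatake ι v.residueCard n α)) → ¬ (n ^ 2 < p ∧ ¬ ((p : ℤ) ∣ NumberField.discr K) ∧ (∀ w : HeightOneSpectrum (𝓞 K), ((p : ℕ) : 𝓞 K) ∈ w.asIdeal → π.1.IsUnramifiedAt w) ∧ (∃ g : GL (Fin n) (PadicAlgCl p), (∀ (σ : Field.absoluteGaloisGroup K) (i j : Fin n),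 ‖((g * ρ σ * g⁻¹ : GL (Fin n) (PadicAlgCl p)) : Matrix (Fin n) (Fin n) (PadicAlgCl p)) i j‖ ≤ 1) ∧ (∀ M : Matrix (Fin n) (Fin n) ℤ, M.det = 1 → ∃ σ : Field.absoluteGaloisGroup K, ∀ i j : Fin n, ‖((g * ρ σ * g⁻¹ : GL (Fin n) (PadicAlgCl p)) : Matrix (Fin n) (Fin n) (PadicAlgCl p)) i j - ((M i j : ℤ) : PadicAlgCl p)‖ < 1)) ∧ (∃ l : ℕ, l.Prime ∧ l ≠ p ∧ ∀ w : HeightOneSpectrum (𝓞 K), ((l : ℕ) : 𝓞 K) ∈ w.asIdeal → w.residueCard = l ∧ ρ.IsUnramifiedAt w ∧ ∃ a : Fin n → PadicAlgCl p, ρ.HasFrobCharpolyAt w (∏ i, (X - C (a i))) ∧ ∀ i j : Fin n, i ≠ j → ‖a i - a j‖ = 1 ∧ ‖a i - (l : PadicAlgCl p) * a j‖ = 1)) → (n ^ 2 < p ∧ (¬ ∃ ζ : K, IsPrimitiveRoot ζ p) ∧ (ρ.restrictField (CyclotomicField p K)).IsResiduallyAbsIrreducible ∧ (∃ l : ℕ,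 l.Prime ∧ l ≠ p ∧ ¬ (p ∣ (l - 1)) ∧ ¬ ((l : ℤ) ∣ NumberField.discr K) ∧ ∀ w : HeightOneSpectrum (𝓞 K), ((l : ℕ) : 𝓞 K) ∈ w.asIdeal → w.residueCard = l ∧ ρ.IsUnramifiedAt w ∧ ∃ a : Fin n → PadicAlgCl p, ρ.HasFrobCharpolyAt w (∏ i, (X - C (a i))) ∧ ∀ i j : Fin n, i ≠ j → ‖a i - (l : PadicAlgCl p) * a j‖ = 1) ∧ (∀ w : HeightOneSpectrum (𝓞 K), ((p : ℕ) : 𝓞 K) ∈ w.asIdeal → ∀ art : LocalArtinData (w.adicCompletion K), art.IsCanonical → ρ.IsOrdinaryRegularAt w art)) → ∀ v : HeightOneSpectrum (𝓞 K), ((p : ℕ) : 𝓞 K) ∉ v.asIdeal → ∃ W : WeilDeligneRep (v.adicCompletion K) (PadicAlgCl p) (Fin n → PadicAlgCl p), IsWeilDeligneOfLadic (ρ.toLocal v).toWeilGroupHom W ∧ ∀ f : (Fin n → PadicAlgCl p) →ₗ[PadicAlgCl p] (Fin n → PadicAlgCl p), (∀ w : WeilGroup (v.adicCompletion K), f ∘ₗ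 W.ρ w = ((IsNonarchimedeanLocalField.residueFieldCard (v.adicCompletion K) : PadicAlgCl p) ^ (WeilGroup.deg w)) • (W.ρ w ∘ₗ f)) → f ∘ₗ W.N = W.N ∘ₗ f → f = 0

/-- stub P — POTENTIAL ORDINARY GENERICITY (the cell's open content, PRINT modulo typed junctions): for MB data (K CM, π RA cuspidal, ρ semisimple Satake-compatible, n² < p, ζ_p ∉ K, r̄|K(ζ_p) abs. irreducible, a fully decomposed generic prime, ρ ordinary at all w ∣ p) there is a finite F'/K over which every WD rep attached to ρ|W_{F'_u}, u ∤ p, is generic. Route: J0 (ρ algebraic: ORD ⇒ de Rham, Matsumoto Lemma 3.31; a.e. unramified from Satake) → Matsumoto arXiv:2312.01551 Thm 5.22 (F' CM Galois, Π ι-ordinary cuspidal, ρ|G_{F'} ≅ r_ι(Π), F-ss LGC at u ∤ p) → AHTW arXiv:2607.11763 Prop 6.0.5 (= tree fact AHTW2026_prop_6_0_5_generic_conj) + Frobenius-semisimplification invariance (sibling support MonodromyRankLadder.FrobSemisimplificationGeneric) + GD uniqueness (IsWeilDeligneOfLadic.isEquivalent, PROVED). -/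
theorem stub_potentialOrdinaryGenericity :
    open IsDedekindDomain NumberField Polynomial Filter Literature.NumberTheory.Automorphic Literature.NumberTheory.GaloisRepresentations in ∀ (K : Type) [Field K] [NumberField K], NumberField.IsCMField K → ∀ (n : ℕ) (hcpt : isCompact_glFiniteIntegralLevel n K) (π : CuspidalAutomorphicRepData n K hcpt), π.1.IsRegularAlgebraic → ∀ (p : ℕ) [Fact p.Prime] (ι : PadicAlgCl p ≃+* ℂ) (ρ : FramedGaloisRep K (PadicAlgCl p) n), ρ.toGaloisRep.IsSemisimple → (∀ᶠ v : HeightOneSpectrum (𝓞 K) in cofinite, ∀ α : Multiset ℂ, π.1.HasSatakeParamAt v α → ρ.IsUnramifiedAt v ∧ ρ.HasFrobCharpolyAt v (arithFrobPolyOfSatake ι v.residueCard n α)) → (n ^ 2 < p ∧ (¬ ∃ ζ : K, IsPrimitiveRoot ζ p) ∧ (ρ.restrictField (CyclotomicField p K)).IsResiduallyAbsIrreducible ∧ (∃ l : ℕ, l.Prime ∧ l ≠ p ∧ ¬ (p ∣ (l - 1)) ∧ ¬ ((l : ℤ) ∣ NumberField.discr K) ∧ ∀ w : HeightOneSpectrum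 (𝓞 K), ((l : ℕ) : 𝓞 K) ∈ w.asIdeal → w.residueCard = l ∧ ρ.IsUnramifiedAt w ∧ ∃ a : Fin n → PadicAlgCl p, ρ.HasFrobCharpolyAt w (∏ i, (X - C (a i))) ∧ ∀ i j : Fin n, i ≠ j → ‖a i - (l : PadicAlgCl p) * a j‖ = 1) ∧ (∀ w : HeightOneSpectrum (𝓞 K), ((p : ℕ) : 𝓞 K) ∈ w.asIdeal → ∀ art : LocalArtinData (w.adicCompletion K), art.IsCanonical → ρ.IsOrdinaryRegularAt w art)) → ∃ (F' : Type) (_ : Field F') (_ : NumberField F') (_ : Algebra K F'), ∀ u : HeightOneSpectrum (𝓞 F'), ((p : ℕ) : 𝓞 F') ∉ u.asIdeal → ∃ W' : WeilDeligneRep (u.adicCompletion F') (PadicAlgCl p) (Fin n → PadicAlgCl p), IsWeilDeligneOfLadic ((ρ.restrictField F').toLocal u).toWeilGroupHom W' ∧ ∀ f : (Fin n → PadicAlgCl p) →ₗ[PadicAlgCl p] (Fin n → PadicAlgCl p), (∀ w : WeilGroup (u.adicCompletion F'), f ∘ₗ W'.ρ w = ((IsNonarchimedeanLocalField.residueFieldCard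 (u.adicCompletion F') : PadicAlgCl p) ^ (WeilGroup.deg w)) • (W'.ρ w ∘ₗ f)) → f ∘ₗ W'.N = W'.N ∘ₗ f → f = 0 := by
  sorry

/-- stub D — DESCENT OF GENERICITY along W_{F'_u} ⊂ W_{K_v} (u ∣ v ∤ p): a generic WD rep attached to (ρ|Γ_{F'})|W_{F'_u} ⇒ a generic WD rep attached to ρ|W_{K_v}. Pure local algebra [folklore]: GD existence downstairs (GrothendieckDeligne_exists_isWeilDeligneOfLadic_holds, PROVED), restriction of the GD triple to the open subgroup W_{F'_u} is a GD triple for the restriction (uniqueness IsWeilDeligneOfLadic.isEquivalent), and a non-zero morphism (r,N) → (r(1),N) over W_{K_v} restricts to one over W_{F'_u} because ‖·‖^{deg} is compatible (q_u = q_v^{f(u|v)}). M-sized typing work (restrictField/toLocal compatibility lemma), no number theory. -/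
theorem stub_genericityDescends :
    open IsDedekindDomain NumberField Polynomial Filter Literature.NumberTheory.Automorphic Literature.NumberTheory.GaloisRepresentations in ∀ (K : Type) [Field K] [NumberField K] (F' : Type) [Field F'] [NumberField F'] [Algebra K F'] (p n : ℕ) [Fact p.Prime] (ρ : FramedGaloisRep K (PadicAlgCl p) n) (v : HeightOneSpectrum (𝓞 K)) (u : HeightOneSpectrum (𝓞 F')), u.asIdeal.comap (algebraMap (𝓞 K) (𝓞 F')) = v.asIdeal → ((p : ℕ) : 𝓞 K) ∉ v.asIdeal → (∃ W' : WeilDeligneRep (u.adicCompletion F') (PadicAlgCl p) (Fin n → PadicAlgCl p), IsWeilDeligneOfLadic ((ρ.restrictField F').toLocal u).toWeilGroupHom W' ∧ ∀ f : (Fin n → PadicAlgCl p) →ₗ[PadicAlgCl p] (Fin n → PadicAlgCl p), (∀ w : WeilGroup (u.adicCompletion F'), f ∘ₗ W'.ρ w = ((IsNonarchimedeanLocalField.residueFieldCard (u.adicCompletion F') : PadicAlgCl p) ^ (WeilGroup.deg w)) • (W'.ρ w ∘ₗ f)) → f ∘ₗ W'.N = W'.N ∘ₗ f → f = 0) → ∃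 W : WeilDeligneRep (v.adicCompletion K) (PadicAlgCl p) (Fin n → PadicAlgCl p), IsWeilDeligneOfLadic (ρ.toLocal v).toWeilGroupHom W ∧ ∀ f : (Fin n → PadicAlgCl p) →ₗ[PadicAlgCl p] (Fin n → PadicAlgCl p), (∀ w : WeilGroup (v.adicCompletion K), f ∘ₗ W.ρ w = ((IsNonarchimedeanLocalField.residueFieldCard (v.adicCompletion K) : PadicAlgCl p) ^ (WeilGroup.deg w)) • (W.ρ w ∘ₗ f)) → f ∘ₗ W.N = W.N ∘ₗ f → f = 0 := by
  sorry

open IsDedekindDomain Literature.NumberTheory.GaloisRepresentations in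
/-- `OrdinaryBoxGenericMonodromy` from its two stubs (kernel-checked, no sorry): instantiate P at the MB datum, pick a place `u` of `F'` over `v`
(`Ideal.exists_ideal_over_maximal_of_isIntegral` for `𝓞 K → 𝓞 F'`), check `p ∉ u`, descend genericity by D. -/
theorem OrdinaryBoxGenericMonodromy_of
    (hP : open IsDedekindDomain NumberField Polynomial Filter Literature.NumberTheory.Automorphic Literature.NumberTheory.GaloisRepresentations in ∀ (K : Type) [Field K] [NumberField K], NumberField.IsCMField K → ∀ (n : ℕ) (hcpt : isCompact_glFiniteIntegralLevel n K) (π : CuspidalAutomorphicRepData n K hcpt), π.1.IsRegularAlgebraic → ∀ (p : ℕ) [Fact p.Prime] (ι : PadicAlgCl p ≃+* ℂ) (ρ : FramedGaloisRep K (PadicAlgCl p) n), ρ.toGaloisRep.IsSemisimple → (∀ᶠ v : HeightOneSpectrum (𝓞 K) in cofinite, ∀ α : Multiset ℂ, π.1.HasSatakeParamAt v α → ρ.IsUnramifiedAt v ∧ ρ.HasFrobCharpolyAt v (arithFrobPolyOfSatake ι v.residueCard n α)) → (n ^ 2 < p ∧ (¬ ∃ ζ : K, IsPrimitiveRoot ζ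 p) ∧ (ρ.restrictField (CyclotomicField p K)).IsResiduallyAbsIrreducible ∧ (∃ l : ℕ, l.Prime ∧ l ≠ p ∧ ¬ (p ∣ (l - 1)) ∧ ¬ ((l : ℤ) ∣ NumberField.discr K) ∧ ∀ w : HeightOneSpectrum (𝓞 K), ((l : ℕ) : 𝓞 K) ∈ w.asIdeal → w.residueCard = l ∧ ρ.IsUnramifiedAt w ∧ ∃ a : Fin n → PadicAlgCl p, ρ.HasFrobCharpolyAt w (∏ i, (X - C (a i))) ∧ ∀ i j : Fin n, i ≠ j → ‖a i - (l : PadicAlgCl p) * a j‖ = 1) ∧ (∀ w : HeightOneSpectrum (𝓞 K), ((p : ℕ) : 𝓞 K) ∈ w.asIdeal → ∀ art : LocalArtinData (w.adicCompletion K), art.IsCanonical → ρ.IsOrdinaryRegularAt w art)) → ∃ (F' : Type) (_ : Field F') (_ : NumberField F') (_ : Algebra K F'), ∀ u : HeightOneSpectrum (𝓞 F'), ((p : ℕ) : 𝓞 F') ∉ u.asIdeal → ∃ W' : WeilDeligneRep (u.adicCompletion F') (PadicAlgCl p) (Fin n → PadicAlgCl p), IsWeilDeligneOfLadic ((ρ.restrictField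 F').toLocal u).toWeilGroupHom W' ∧ ∀ f : (Fin n → PadicAlgCl p) →ₗ[PadicAlgCl p] (Fin n → PadicAlgCl p), (∀ w : WeilGroup (u.adicCompletion F'), f ∘ₗ W'.ρ w = ((IsNonarchimedeanLocalField.residueFieldCard (u.adicCompletion F') : PadicAlgCl p) ^ (WeilGroup.deg w)) • (W'.ρ w ∘ₗ f)) → f ∘ₗ W'.N = W'.N ∘ₗ f → f = 0)
    (hD : open IsDedekindDomain NumberField Polynomial Filter Literature.NumberTheory.Automorphic Literature.NumberTheory.GaloisRepresentations in ∀ (K : Type) [Field K] [NumberField K] (F' : Type) [Field F'] [NumberField F'] [Algebra K F'] (p n : ℕ) [Fact p.Prime] (ρ : FramedGaloisRep K (PadicAlgCl p) n) (v : HeightOneSpectrum (𝓞 K)) (u : HeightOneSpectrum (𝓞 F')), u.asIdeal.comap (algebraMap (𝓞 K) (𝓞 F')) = v.asIdeal → ((p : ℕ) : 𝓞 K) ∉ v.asIdeal → (∃ W' : WeilDeligneRep (u.adicCompletion F') (PadicAlgCl p) (Fin n → PadicAlgCl p), IsWeilDeligneOfLadic ((ρ.restrictField F').toLocal u).toWeilGroupHom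 W' ∧ ∀ f : (Fin n → PadicAlgCl p) →ₗ[PadicAlgCl p] (Fin n → PadicAlgCl p), (∀ w : WeilGroup (u.adicCompletion F'), f ∘ₗ W'.ρ w = ((IsNonarchimedeanLocalField.residueFieldCard (u.adicCompletion F') : PadicAlgCl p) ^ (WeilGroup.deg w)) • (W'.ρ w ∘ₗ f)) → f ∘ₗ W'.N = W'.N ∘ₗ f → f = 0) → ∃ W : WeilDeligneRep (v.adicCompletion K) (PadicAlgCl p) (Fin n → PadicAlgCl p), IsWeilDeligneOfLadic (ρ.toLocal v).toWeilGroupHom W ∧ ∀ f : (Fin n → PadicAlgCl p) →ₗ[PadicAlgCl p] (Fin n → PadicAlgCl p), (∀ w : WeilGroup (v.adicCompletion K), f ∘ₗ W.ρ w = ((IsNonarchimedeanLocalField.residueFieldCard (v.adicCompletion K) : PadicAlgCl p) ^ (WeilGroup.deg w)) • (W.ρ w ∘ₗ f)) → f ∘ₗ W.N = W.N ∘ₗ f → f = 0) :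
    OrdinaryBoxGenericMonodromy := by
  intro K _ _ hK n hcpt π hπ p _ ι ρ hss hsat hoff hMB v hv
  obtain ⟨F', iF, iNF, iA, hup⟩ := hP K hK n hcpt π hπ p ι ρ hss hsat hMB
  have hker : RingHom.ker (algebraMap (𝓞 K) (𝓞 F')) ≤ v.asIdeal := by
    rw [NumberField.RingOfIntegers.ker_algebraMap_eq_bot K F']
    exact bot_le
  obtain ⟨Q, hQmax, hQ⟩ := Ideal.exists_ideal_over_maximal_of_isIntegral v.asIdeal hker
  have hQne : Q ≠ ⊥ := by
    rintro rfl
    apply v.ne_bot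
    rw [← hQ]
    exact NumberField.RingOfIntegers.ker_algebraMap_eq_bot K F'
  let u : HeightOneSpectrum (𝓞 F') := ⟨Q, hQmax.isPrime, hQne⟩
  have hu : ((p : ℕ) : 𝓞 F') ∉ u.asIdeal := by
    intro hpu
    apply hv
    rw [← hQ, Ideal.mem_comap, map_natCast]
    exact hpu
  exact hD K F' p n ρ v u hQ hv (hup u hu)

/-- The skeleton concludes the cell BY NAME from the registered stubs. -/
theorem OrdinaryBoxGenericMonodromy_of_stubs : OrdinaryBoxGenericMonodromy := OrdinaryBoxGenericMonodromy_of stub_potentialOrdinaryGenericity stub_genericityDescends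

/-! ### BC5 rungs of the deciding cell ORDBOX (PLAN-ONLY named stubs; NOT consumed by `OrdinaryBoxGenericMonodromy_of`)
* rung A `stub_rung_ordinaryBoxRankTwo` — ORDBOX ∣ `n = 2` (`rungA_of_cell`): GL₂ over a CM field at a FIXED ordinary `p` outside the host's range; PRINT as a
  method (Matsumoto Thm 5.22, `n = 2`, + stub D), in the regime (CM field, fixed `p`, all `π`) where the target is NOT known.
* rung B `stub_rung_ordinaryBoxUnramifiedPlace` — ORDBOX ∣ unramified Satake place (`rungB_of_cell`): `N = 0`, genericity from the generic unitary unramified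
  `π_v` (Bernstein–Zelevinsky); a KNOWN rung inside the target's known regime (the honest floor; exercises the currency, not the lever).
-/

/-- BC5 rung A text: ORDBOX ∣ n = 2. -/
def OrdinaryBoxRankTwoRung : Prop :=
  open IsDedekindDomain NumberField Polynomial Filter Literature.NumberTheory.Automorphic Literature.NumberTheory.GaloisRepresentations in ∀ (K : Type) [Field K] [NumberField K], NumberField.IsCMField K → ∀ (n : ℕ) (hcpt : isCompact_glFiniteIntegralLevel n K) (π : CuspidalAutomorphicRepData n K hcpt), π.1.IsRegularAlgebraic → ∀ (p : ℕ) [Fact p.Prime] (ι : PadicAlgCl p ≃+* ℂ) (ρ : FramedGaloisRep K (PadicAlgCl p) n), ρ.toGaloisRep.IsSemisimple → (∀ᶠ v : HeightOneSpectrum (𝓞 K) in cofinite, ∀ α : Multiset ℂ, π.1.HasSatakeParamAt v α → ρ.IsUnramifiedAt v ∧ ρ.HasFrobCharpolyAt v (arithFrobPolyOfSatake ι v.residueCard n α)) → ¬ (n ^ 2 < p ∧ ¬ ((p : ℤ) ∣ NumberField.discr K) ∧ (∀ w : HeightOneSpectrum (𝓞 K), ((p : ℕ) : 𝓞 K) ∈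 w.asIdeal → π.1.IsUnramifiedAt w) ∧ (∃ g : GL (Fin n) (PadicAlgCl p), (∀ (σ : Field.absoluteGaloisGroup K) (i j : Fin n), ‖((g * ρ σ * g⁻¹ : GL (Fin n) (PadicAlgCl p)) : Matrix (Fin n) (Fin n) (PadicAlgCl p)) i j‖ ≤ 1) ∧ (∀ M : Matrix (Fin n) (Fin n) ℤ, M.det = 1 → ∃ σ : Field.absoluteGaloisGroup K, ∀ i j : Fin n, ‖((g * ρ σ * g⁻¹ : GL (Fin n) (PadicAlgCl p)) : Matrix (Fin n) (Fin n) (PadicAlgCl p)) i j - ((M i j : ℤ) : PadicAlgCl p)‖ < 1)) ∧ (∃ l : ℕ, l.Prime ∧ l ≠ p ∧ ∀ w : HeightOneSpectrum (𝓞 K), ((l : ℕ) : 𝓞 K) ∈ w.asIdeal → w.residueCard = l ∧ ρ.IsUnramifiedAt w ∧ ∃ a : Fin n → PadicAlgCl p, ρ.HasFrobCharpolyAt w (∏ i, (X - C (a i))) ∧ ∀ i j : Fin n, i ≠ j → ‖a i - a j‖ = 1 ∧ ‖a i - (l : PadicAlgCl p) * a j‖ = 1)) → (n ^ 2 < p ∧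 (¬ ∃ ζ : K, IsPrimitiveRoot ζ p) ∧ (ρ.restrictField (CyclotomicField p K)).IsResiduallyAbsIrreducible ∧ (∃ l : ℕ, l.Prime ∧ l ≠ p ∧ ¬ (p ∣ (l - 1)) ∧ ¬ ((l : ℤ) ∣ NumberField.discr K) ∧ ∀ w : HeightOneSpectrum (𝓞 K), ((l : ℕ) : 𝓞 K) ∈ w.asIdeal → w.residueCard = l ∧ ρ.IsUnramifiedAt w ∧ ∃ a : Fin n → PadicAlgCl p, ρ.HasFrobCharpolyAt w (∏ i, (X - C (a i))) ∧ ∀ i j : Fin n, i ≠ j → ‖a i - (l : PadicAlgCl p) * a j‖ = 1) ∧ (∀ w : HeightOneSpectrum (𝓞 K), ((p : ℕ) : 𝓞 K) ∈ w.asIdeal → ∀ art : LocalArtinData (w.adicCompletion K), art.IsCanonical → ρ.IsOrdinaryRegularAt w art)) → n = 2 → ∀ v : HeightOneSpectrum (𝓞 K), ((p : ℕ) : 𝓞 K) ∉ v.asIdeal → ∃ W : WeilDeligneRep (v.adicCompletion K) (PadicAlgCl p) (Fin n → PadicAlgCl p), IsWeilDeligneOfLadic (ρ.toLocal v).toWeilGroupHom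 W ∧ ∀ f : (Fin n → PadicAlgCl p) →ₗ[PadicAlgCl p] (Fin n → PadicAlgCl p), (∀ w : WeilGroup (v.adicCompletion K), f ∘ₗ W.ρ w = ((IsNonarchimedeanLocalField.residueFieldCard (v.adicCompletion K) : PadicAlgCl p) ^ (WeilGroup.deg w)) • (W.ρ w ∘ₗ f)) → f ∘ₗ W.N = W.N ∘ₗ f → f = 0

/-- BC5 rung B text: ORDBOX ∣ unramified Satake place. -/
def OrdinaryBoxUnramifiedPlaceRung : Prop :=
  open IsDedekindDomain NumberField Polynomial Filter Literature.NumberTheory.Automorphic Literature.NumberTheory.GaloisRepresentations in ∀ (K : Type) [Field K] [NumberField K], NumberField.IsCMField K → ∀ (n : ℕ) (hcpt : isCompact_glFiniteIntegralLevel n K) (π : CuspidalAutomorphicRepData n K hcpt), π.1.IsRegularAlgebraic → ∀ (p : ℕ) [Fact p.Prime] (ι : PadicAlgCl p ≃+* ℂ) (ρ : FramedGaloisRep K (PadicAlgCl p) n), ρ.toGaloisRep.IsSemisimple → (∀ᶠ v : HeightOneSpectrum (𝓞 K) in cofinite, ∀ α : Multiset ℂ, π.1.HasSatakeParamAt v α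 → ρ.IsUnramifiedAt v ∧ ρ.HasFrobCharpolyAt v (arithFrobPolyOfSatake ι v.residueCard n α)) → ¬ (n ^ 2 < p ∧ ¬ ((p : ℤ) ∣ NumberField.discr K) ∧ (∀ w : HeightOneSpectrum (𝓞 K), ((p : ℕ) : 𝓞 K) ∈ w.asIdeal → π.1.IsUnramifiedAt w) ∧ (∃ g : GL (Fin n) (PadicAlgCl p), (∀ (σ : Field.absoluteGaloisGroup K) (i j : Fin n), ‖((g * ρ σ * g⁻¹ : GL (Fin n) (PadicAlgCl p)) : Matrix (Fin n) (Fin n) (PadicAlgCl p)) i j‖ ≤ 1) ∧ (∀ M : Matrix (Fin n) (Fin n) ℤ, M.det = 1 → ∃ σ : Field.absoluteGaloisGroup K, ∀ i j : Fin n, ‖((g * ρ σ * g⁻¹ : GL (Fin n) (PadicAlgCl p)) : Matrix (Fin n) (Fin n) (PadicAlgCl p)) i j - ((M i j : ℤ) : PadicAlgCl p)‖ < 1)) ∧ (∃ l : ℕ, l.Prime ∧ l ≠ p ∧ ∀ w : HeightOneSpectrum (𝓞 K), ((l : ℕ) : 𝓞 K) ∈ w.asIdeal → w.residueCard = l ∧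 ρ.IsUnramifiedAt w ∧ ∃ a : Fin n → PadicAlgCl p, ρ.HasFrobCharpolyAt w (∏ i, (X - C (a i))) ∧ ∀ i j : Fin n, i ≠ j → ‖a i - a j‖ = 1 ∧ ‖a i - (l : PadicAlgCl p) * a j‖ = 1)) → (n ^ 2 < p ∧ (¬ ∃ ζ : K, IsPrimitiveRoot ζ p) ∧ (ρ.restrictField (CyclotomicField p K)).IsResiduallyAbsIrreducible ∧ (∃ l : ℕ, l.Prime ∧ l ≠ p ∧ ¬ (p ∣ (l - 1)) ∧ ¬ ((l : ℤ) ∣ NumberField.discr K) ∧ ∀ w : HeightOneSpectrum (𝓞 K), ((l : ℕ) : 𝓞 K) ∈ w.asIdeal → w.residueCard = l ∧ ρ.IsUnramifiedAt w ∧ ∃ a : Fin n → PadicAlgCl p, ρ.HasFrobCharpolyAt w (∏ i, (X - C (a i))) ∧ ∀ i j : Fin n, i ≠ j → ‖a i - (l : PadicAlgCl p) * a j‖ = 1) ∧ (∀ w : HeightOneSpectrum (𝓞 K), ((p : ℕ) : 𝓞 K) ∈ w.asIdeal → ∀ art : LocalArtinData (w.adicCompletion K), art.IsCanonical → ρ.IsOrdinaryRegularAt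 w art)) → ∀ v : HeightOneSpectrum (𝓞 K), ((p : ℕ) : 𝓞 K) ∉ v.asIdeal → (∃ α : Multiset ℂ, π.1.HasSatakeParamAt v α) → ρ.IsUnramifiedAt v → ∃ W : WeilDeligneRep (v.adicCompletion K) (PadicAlgCl p) (Fin n → PadicAlgCl p), IsWeilDeligneOfLadic (ρ.toLocal v).toWeilGroupHom W ∧ ∀ f : (Fin n → PadicAlgCl p) →ₗ[PadicAlgCl p] (Fin n → PadicAlgCl p), (∀ w : WeilGroup (v.adicCompletion K), f ∘ₗ W.ρ w = ((IsNonarchimedeanLocalField.residueFieldCard (v.adicCompletion K) : PadicAlgCl p) ^ (WeilGroup.deg w)) • (W.ρ w ∘ₗ f)) → f ∘ₗ W.N = W.N ∘ₗ f → f = 0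

/-- **BC5 rung A (plan-only)** — BC5 rung A (PLAN-ONLY): ORDBOX ∣ n = 2 — GL₂ over a CM field at a FIXED ordinary prime p ≥ 5 outside the host's patching range (p ∣ disc K or π Iwahori-ramified above p or small adequate image); PRINT as a method (Matsumoto Thm 5.22 with n = 2 + stub D); regime where Langlands ∣ n = 2 over CM fields (all π, fixed p) is NOT known; `rungA_of_cell : ORDBOX → rung`. -/
theorem stub_rung_ordinaryBoxRankTwo : OrdinaryBoxRankTwoRung := by
  sorry

/-- **BC5 rung B (plan-only, KNOWN floor)** — BC5 rung B (PLAN-ONLY, KNOWN floor): ORDBOX ∣ v an unramified Satake place of (π, ρ) — N = 0 and genericity = no Satake pair with α_i = q α_j (π_v unitary generic unramified ⇒ irreducible principal series, Bernstein–Zelevinsky / Jacquet–Shalika); inside the target's known regime — the ladder's floor, not a witness of the lever; `rungB_of_cell`. -/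
theorem stub_rung_ordinaryBoxUnramifiedPlace : OrdinaryBoxUnramifiedPlaceRung := by
  sorry

/-- rung A IS the `n = 2` restriction of the cell. -/
theorem rungA_of_cell (h : OrdinaryBoxGenericMonodromy) : OrdinaryBoxRankTwoRung :=
  fun K _ _ hK n hcpt π hπ p _ ι ρ hss hsat hoff hMB _ => h K hK n hcpt π hπ p ι ρ hss hsat hoff hMB

/-- rung B IS the unramified-place restriction of the cell. -/
theorem rungB_of_cell (h : OrdinaryBoxGenericMonodromy) : OrdinaryBoxUnramifiedPlaceRung :=
  fun K _ _ hK n hcpt π hπ p _ ι ρ hss hsat hoff hMB v hv _ _ => h K hK n hcpt π hπ p ι ρ hss hsat hoff hMB v hv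

/-- identity with the born route decl (elaborates only AFTER birth). -/
theorem OrdinaryBoxGenericMonodromy_iff_route : OrdinaryBoxGenericMonodromy ↔ Summit.Langlands.Langlands.Theses.SmallRangeOrdinaryCarving.OrdinaryBoxGenericMonodromy := Iff.rfl

/-- the ROUTE decl from the stubs. -/
theorem route_OrdinaryBoxGenericMonodromy_of_stubs : Summit.Langlands.Langlands.Theses.SmallRangeOrdinaryCarving.OrdinaryBoxGenericMonodromy := OrdinaryBoxGenericMonodromy_iff_route.1 OrdinaryBoxGenericMonodromy_of_stubs

end Summit.Langlands.Langlands.Theses.SmallRangeOrdinaryCarving.Birth.OrdinaryBoxGenericMonodromy
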